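import Summits.BirchSwinnertonDyer.Rank1Residual.F1Sign2.ConductorBitSpinLawAtTwo
import HarnessLib

/-!
# DESC-37 kernel — REF1-AUDIT §234's BC7 certificates a–d for `F1Sign2/ConductorBitSpinLawAtTwo.lean` (`REF1-data/b234/Probe234.lean` d2bdfa7c3295298c l.146–196 VERBATIM up to the
# namespace — `…F1Sign2.ConductorBitSpinLaw.Kernel` for REF1's `…F1Sign2.REF1_234` — and one typer-added docstring) + the typer's discharge of rider R234a (`cubicDiscZ_X_cube_sub_X`)
# (typer -ty g20)

CONTENT (all PROVED, no `sorry`, no new `def`): BC7-a — the two 2-adic square-class carriers are inhabited as intended (`17`, `−7`, `68` are 2-adic squares; `−3`, `20` give the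
unramified quadratic extension; five `example`s) · BC7-b `sq_unr_aux`, `not_square_and_unramified` — `IsTwoAdicSquare D` and `IsTwoAdicUnramifiedNonsquare D` are mutually exclusive, so
the case split inside `ConductorOddAboveTwo` is a genuine dichotomy and, with `OneTwoAdicRoot`'s `¬ IsTwoAdicSquare`, «¬ unramified» there means «ramified» · BC7-c `twoDivisionCubicZ_eval`
— `F(4x) = 16·(4x³ + b₂x² + 2b₄x + b₆)` (the integral 2-division cubic is the b-model cubic rescaled; roots `4eᵢ`) · BC7-d `fits_nil_of_no_member` — DESC-37-A is an EXISTENCE claim (with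
no genus-class-trivial member the pure law fits vacuously) · R234a `cubicDiscZ_X_cube_sub_X : cubicDiscZ (X ^ 3 - X) = 4` — Mathlib's `Polynomial.resultant` orientation makes -desc's
`cubicDiscZ F = −Res(F, F′)` the usual discriminant (positive on three real roots; pari `poldisc`), via `Polynomial.resultant_eq_prod_eval` (`Res(f, g) = lc(f)ⁿ·∏_{f(α)=0} g(α)` for
split `f`): `Res(X³ − X, 3X² − 1) = F′(0)·F′(1)·F′(−1) = −4`.  BSD is not proved by this; 23715 is not closed by this.
-/

noncomputable section

open scoped Classical

open WeierstrassCurve Literature.NumberTheory.EllipticCurves Polynomial IsDedekindDomain NumberField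
open Summit.BirchSwinnertonDyer.Rank1Residual.F1Sign2

namespace Summit.BirchSwinnertonDyer.Rank1Residual.F1Sign2.ConductorBitSpinLaw.Kernel

/-- BC7-a (the two 2-adic square-class carriers are inhabited as intended; kernel arithmetic):
`17`, `-7`, `68` are 2-adic squares; `-3`, `20` give the unramified quadratic extension. -/
example : IsTwoAdicSquare 17 := ⟨0, 17, by norm_num, by decide⟩
example : IsTwoAdicSquare (-7) := ⟨0, -7, by norm_num, by decide⟩
example : IsTwoAdicSquare 68 := ⟨1, 17, by norm_num, by decide⟩
example : IsTwoAdicUnramifiedNonsquare (-3) := ⟨0, -3, by norm_num, by decide⟩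
example : IsTwoAdicUnramifiedNonsquare 20 := ⟨1, 5, by norm_num, by decide⟩

/-- (Typer-added docstring.) BC7-b, arithmetic core: `4^k·u = 4^{k'}·u'` is impossible with `u ≡ 1`, `u' ≡ 5 (mod 8)` (induction on `k`). -/
theorem sq_unr_aux : ∀ (k k' : ℕ) (u u' : ℤ), u % 8 = 1 → u' % 8 = 5 → (4 : ℤ) ^ k * u = 4 ^ k' * u' → False := by
  intro k
  induction k with
  | zero =>
    intro k' u u' hu hu' h
    cases k' with
    | zero => simp at h; omega
    | succ k'' =>
      rw [pow_zero, one_mul, pow_succ] at h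
      have : (4 : ℤ) ∣ u := ⟨4 ^ k'' * u', by rw [h]; ring⟩
      omega
  | succ k ih =>
    intro k' u u' hu hu' h
    cases k' with
    | zero =>
      rw [pow_zero, one_mul, pow_succ] at h
      have : (4 : ℤ) ∣ u' := ⟨4 ^ k * u, by rw [← h]; ring⟩
      omega
    | succ k'' =>
      rw [pow_succ, pow_succ, mul_right_comm ((4 : ℤ) ^ k), mul_right_comm ((4 : ℤ) ^ k'')] at h
      exact ih k'' u u' hu hu' (mul_right_cancel₀ (by norm_num) h)

/-- BC7-b (the two carriers are mutually exclusive, so the case split inside `ConductorOddAboveTwo` is a genuine dichotomy and,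
together with `OneTwoAdicRoot`'s `¬ IsTwoAdicSquare`, «¬ unramified» there means «ramified»; kernel). -/
theorem not_square_and_unramified (D : ℤ) (h1 : IsTwoAdicSquare D) (h2 : IsTwoAdicUnramifiedNonsquare D) : False := by
  obtain ⟨k, u, rfl, hu⟩ := h1
  obtain ⟨k', u', h, hu'⟩ := h2
  exact sq_unr_aux k k' u u' hu hu' h

/-- BC7-c (the integral 2-division cubic is the b-model cubic rescaled: `F(4x) = 16·(4x³ + b₂x² + 2b₄x + b₆)` at every integer `x`,
so its roots are `4e_i`; kernel). -/
theorem twoDivisionCubicZ_eval (B2 B4 B6 x : ℤ) :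
    (twoDivisionCubicZ B2 B4 B6).eval (4 * x) = 16 * (4 * x ^ 3 + B2 * x ^ 2 + 2 * B4 * x + B6) := by
  simp [twoDivisionCubicZ]
  ring

/-- BC7-d (DESC-37-A is an EXISTENCE claim — its conclusion `¬ CorrectedSpinLawFits … []` is not closed by the empty family: if NO genus-class-trivial
member existed the pure law would fit vacuously and 37-A would be FALSE there; so any proof must produce a member `(n, p)` with labelled roots where
`κ ≠ spin`.  Kernel form of the contrapositive bookkeeping.) -/
theorem fits_nil_of_no_member (W : WeierstrassCurve ℚ) [W.IsElliptic] [W.IsGloballyMinimal] (c xnum : ℤ[X]) (xden : ℕ)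
    (h : ∀ n p : ℕ, ¬ GenusTrivialTwistMember W n p) : CorrectedSpinLawFits W c xnum xden [] := by
  intro n p hm
  exact absurd hm (h n p)

/-- **R234a discharged (typer; REF1-AUDIT §234).**  Mathlib's resultant orientation gives -desc's `cubicDiscZ F = −Res(F, F′)` the standard sign: for the split monic cubic
`X³ − X = X(X − 1)(X + 1)` (three real roots) `cubicDiscZ (X³ − X) = −F′(0)·F′(1)·F′(−1) = −(−1·2·2) = 4 > 0` — pari's `poldisc(x^3 - x) = 4`.  Hence `IsTwoAdicUnramifiedNonsquare
(cubicDiscZ F)` reads `disc F ≡ 5 (mod 8)·4^k` with the usual `disc`, as ENGINE 38 computes it. -/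
theorem cubicDiscZ_X_cube_sub_X : cubicDiscZ (X ^ 3 - X) = 4 := by
  have hs : (X ^ 3 - X : ℤ[X]) = (X + C 0) * ((X + C (-1)) * (X + C 1)) := by
    simp only [map_zero, add_zero, map_neg, map_one]
    ring
  have hsplit : (X ^ 3 - X : ℤ[X]).Splits := by
    rw [hs]; exact (Splits.X_add_C _).mul ((Splits.X_add_C _).mul (Splits.X_add_C _))
  have hmonic : (X ^ 3 - X : ℤ[X]).Monic := by
    rw [hs]; exact (monic_X_add_C _).mul ((monic_X_add_C _).mul (monic_X_add_C _))
  have hd : derivative (X ^ 3 - X : ℤ[X]) = C 3 * X ^ 2 - 1 := by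
    simp
  unfold cubicDiscZ
  rw [resultant_eq_prod_eval _ _ _ le_rfl hsplit, hmonic.leadingCoeff, one_pow, one_mul, hd, hs,
    roots_mul (by rw [← hs]; exact hmonic.ne_zero), roots_mul ?_, roots_X_add_C, roots_X_add_C, roots_X_add_C]
  · simp
  · exact mul_ne_zero (monic_X_add_C _).ne_zero (monic_X_add_C _).ne_zero

end Summit.BirchSwinnertonDyer.Rank1Residual.F1Sign2.ConductorBitSpinLaw.Kernel

end
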